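import Summits.BirchSwinnertonDyer.Rank1Residual.X11b.BDPRouteSelmerLevelBoundTorsion
import Summits.BirchSwinnertonDyer.Rank1Residual.X11b.BDPRouteLocalIndexTorsion
import Summits.BirchSwinnertonDyer.Rank1Residual.X11b.BDPRouteSelmerCountExact
import Summits.BirchSwinnertonDyer.Rank1Residual.X11b.LocalPrimaryCohomologyEP
import HarnessLib

/-!
# Crux `AnticycControlAdditiveK` (route `SchneiderFreeAdditiveX3`, item stmt-BirchSwinnertonDyer-19295),
# stub `stub_baseCountTors` (P6-add-tors) on regime B2 (`E(K)[p] ≠ 0`): FINITENESS of Castella's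
# `Sel_𝔭(K, E[p^∞])` at a rank-one datum with NO torsion hypothesis

Seat `bsd-schneider-door-c6` (cell `bsd-schneider-ideate`). Every Poitou–Tate input of the control crux
on regime B2 (`g ≥ 1`: (P9), (P9-𝓒), (L10), the count itself) hinges on the FINITENESS of Castella's
Selmer group `Sel_𝔭(K, E[p^∞])` (`selmerAcBase`). The X11b route-p2 level bound
`SelmerLevelBound.natCard_level_le_of_indices_torsion` (sub-cell multr1-p2 gen 17) — JSW17 Prop. 3.2.1
`≤` at level `p^k` — asks for the rank-one index identity `[E(K) : p^k E(K)] = M = [E(K_𝔭) : T + p^k E(K_𝔭)]`,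
which FAILS when `E(K)` has `p`-torsion (`[E(K) : p^k E(K)] = p^k · #E(K)_tors[p^k]`). The identity enters
at ONE point (cancelling `M` in Part A); an inequality `[E(K) : p^k E(K)] ≤ M · G` gives the same bound
times `G`, uniformly in `k` with `G = #E(K)_tors` (finite, Mordell–Weil). This file:

* §1 `natCard_level_le_of_indices_anyTorsion` — the level bound with `[E(K) : p^kE(K)] ≤ M · G` and
  `[E(K_𝔭) : p^kE(K_𝔭) + im E(K)] ≤ L₁` (multr1-p2's proof VERBATIM otherwise, credit multr1-p2):
  `#H¹_{𝓛^{(k)}}(K, E[p^k]) ≤ L₁ · (S · L₂ · G)`;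
* §2 `index_range_zsmul_le_mul_card_torsion` (`[A : nA] ≤ n · #A_tors` for a "rank-one" abelian group:
  a coordinate `c : A → ℤ`, `c Q = 1`, `ker c` torsion, `A_tors` finite — NO `A[p] = 0`),
  `torsion_sup_range_nsmul_sup_range_eq` (`T ⊔ (nG ⊔ f(A)) = T ⊔ (nG ⊔ ℤ·f(Q))`, torsion maps to
  torsion; the torsion-aware form of `LocalIndex.range_nsmul_sup_range_eq_of_source`),
  `index_range_nsmul_sup_range_le` (`[G : nG + f(A)] ≤ [G : nG + ℤ·f(Q)]`);
* §3 **`finite_selmerAcBase_of_rankOne_anyTorsion`** — for `E/ℚ` globally minimal, ANY prime `p`, `K`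
  imaginary quadratic with `p` split, `rank E(K) = 1`, `Ш(E/K)` finite and a degree-one `𝔭 ∣ p`:
  `Sel_𝔭(K, E[p^∞])` IS FINITE — door-c4 gen 2's `selmerCardBoundTorsion_of_rankOne_anyReduction` (port of
  multr1-p2's `X11b.selmerCardBoundTorsion_of_rankOne`) run with §1–§2, NO `E(K)[p] = 0`, NO `E(ℚ_p)[p] = 0`,
  NO reduction-type hypothesis. The EXACT exponent (door-c4/referee: `… + g − t`) is not asserted here.

CONDITIONAL on the cited `poitouTate_sum_localTatePairing_eq_zero K` (Milne ADT I 4.10, reciprocity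
half; implied by `poitouTate_selmerStructure_duality K`); Milne I 2.8 at `K_𝔭̄` is the tree theorem
`localEulerPoincareCharacteristic_adicCompletionEP` (team n1011); no `Prop` fact minted; closes nothing by
itself; BSD is not proved by any of this.

References: [JetchevSkinnerWan2017] Prop. 3.2.1 (proof, arXiv:1512.06894 pp. 10–11); [Castella2018]
(3.2.1), (calcul) (arXiv:1704.06608 pp. 5–6); [MilneADT2006] I Thm. 2.8, Thm. 4.10(b).
-/

noncomputable section

open scoped Classical

universe u

set_option linter.dupNamespace false

namespace Summit.BirchSwinnertonDyer.BirchSwinnertonDyer.Theorems.SchneiderFreeAdditiveX3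

open WeierstrassCurve NumberField IsDedekindDomain Field Function
open Literature.NumberTheory.EllipticCurves Literature.NumberTheory.EllipticCurves.GreenbergSelmer
open Literature.NumberTheory.GaloisRepresentations Literature.NumberTheory.GaloisCohomology
open Summit.BirchSwinnertonDyer.Rank1Residual.X11b
open Summit.BirchSwinnertonDyer.Rank1Residual.X11b.AcSelmer
open Summit.BirchSwinnertonDyer.Rank1Residual.X11b.LocBridge
open Summit.BirchSwinnertonDyer.Rank1Residual.X11b.SelmerLevelBound

/-! ## §1. The level bound with a torsion factor `G` -/

section Level

variable (W : WeierstrassCurve ℚ) [W.IsElliptic] (K : Type) [Field K] [NumberField K]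
  (p k : ℕ) [Fact p.Prime] (𝔭 𝔮 : HeightOneSpectrum (𝓞 K))

/-- **THE LEVEL BOUND WITHOUT (iv) AND WITHOUT `E(K)[p] = 0` (JSW17 Prop. 3.2.1 `≤` at level `p^k`,
indices symbolic).** Let `k ≥ 1`, `𝔭 ≠ 𝔮 = σ • 𝔭` with every place above `p` equal to `𝔭` or `𝔮`, and
`T` the torsion subgroup of `E(K_𝔭)`. If `[E(K_𝔭) : p^kE(K_𝔭) + im E(K)] ≤ L₁`,
`[E(K_𝔭) : T + p^kE(K_𝔭)] = M ≠ 0`, `[E(K) : p^kE(K)] ≤ M · G`, `[E(K_𝔭) : (T + p^kE(K_𝔭)) + im E(K)] = L₂`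
and `#Ш(E/K)[p^k] ≤ S`, then `#H¹_{𝓛^{(k)}}(K, E[p^k]) ≤ L₁ · (S · L₂ · G)` — multr1-p2's
`natCard_level_le_of_indices_torsion` VERBATIM with the global index identity weakened to an inequality
(credit: sub-cell multr1-p2). [cite: JetchevSkinnerWan2017, Prop. 3.2.1 (proof, arXiv:1512.06894 pp. 10–11)]
[cite: Castella2018, proof of Thm. 2.3, (3.2.1) and (calcul) (arXiv:1704.06608 pp. 5–6)]
[cite: MilneADT2006, Ch. I, Thm. 4.10(b) and Thm. 2.8] -/
theorem natCard_level_le_of_indices_anyTorsion (hk : 0 < k) (σ : K ≃ₐ[ℚ] K) (hσ : σ • 𝔭 = 𝔮)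
    (h𝔮 : ∀ v : HeightOneSpectrum (𝓞 K), v ≠ 𝔭 → ((p : ℕ) : 𝓞 K) ∈ v.asIdeal → v = 𝔮)
    (hPT : poitouTate_sum_localTatePairing_eq_zero K)
    (hEP : localEulerPoincareCharacteristic (𝔮.adicCompletion K))
    {L₁ L₂ M S G : ℕ}
    (hL₁ : ((Affine.Point.baseChange (W' := W.baseChange K) K (𝔭.adicCompletion K)).range ⊔
        (zsmulAddGroupHom ((p ^ k : ℕ) : ℤ) :
          ((W.baseChange K).baseChange (𝔭.adicCompletion K)).toAffine.Point →+ _).range).index ≤ L₁)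
    (hM : (AddCommGroup.torsion ((W.baseChange K).baseChange (𝔭.adicCompletion K)).toAffine.Point ⊔
        (zsmulAddGroupHom ((p ^ k : ℕ) : ℤ) :
          ((W.baseChange K).baseChange (𝔭.adicCompletion K)).toAffine.Point →+ _).range).index = M)
    (hM0 : M ≠ 0)
    (hN : ((zsmulAddGroupHom ((p ^ k : ℕ) : ℤ) : (W.baseChange K).toAffine.Point →+ _).range).index ≤
      M * G)
    (hL₂ : ((Affine.Point.baseChange (W' := W.baseChange K) K (𝔭.adicCompletion K)).range ⊔
        (AddCommGroup.torsion ((W.baseChange K).baseChange (𝔭.adicCompletion K)).toAffine.Point ⊔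
          (zsmulAddGroupHom ((p ^ k : ℕ) : ℤ) :
            ((W.baseChange K).baseChange (𝔭.adicCompletion K)).toAffine.Point →+ _).range)).index = L₂)
    (hS : Nat.card ↥((W.baseChange K).sha ⊓
        AddSubgroup.torsionBy (W.baseChange K).galH1 ((p ^ k : ℕ) : ℤ)) ≤ S) :
    Finite (acLevelStructure (W.baseChange K) p k 𝔭 ∅).selmerGroup ∧
      Nat.card (acLevelStructure (W.baseChange K) p k 𝔭 ∅).selmerGroup ≤ L₁ * (S * L₂ * G) := by
  haveI hEK : (W.baseChange K).IsElliptic := by rw [baseChange]; infer_instance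
  haveI : NeZero (p ^ k) := ⟨pow_ne_zero _ (Fact.out : p.Prime).ne_zero⟩
  haveI : CharZero (𝔭.adicCompletion K) := charZero_adicCompletion 𝔭
  have hnZ : ((p ^ k : ℕ) : ℤ) ≠ 0 := Int.natCast_ne_zero.mpr (NeZero.ne _)
  set E := W.baseChange K with hE
  set n : ℕ := p ^ k with hn
  set Sel := selmerGroup E (n : ℤ) with hSel
  set KO := kummerOutside E n {Sum.inr 𝔮} with hKO
  set C := ((AddCommGroup.torsion (E.baseChange (𝔭.adicCompletion K)).toAffine.Point).map
      (E.localKummerMap (𝔭.adicCompletion K) hnZ)).comap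
    (galoisCohomology.res (E.torsionGaloisModule (n : ℤ)) (𝔭.adicCompletion K) 1) with hC
  -- (1) glue, torsion-valued condition at `𝔭`
  have hT : ∀ v : HeightOneSpectrum (𝓞 K), v ≠ 𝔭 →
      (((p : ℕ) : 𝓞 K) ∈ v.asIdeal ∨ v ∈ (∅ : Set (HeightOneSpectrum (𝓞 K)))) →
        (Sum.inr v : Place K) ∈ ({Sum.inr 𝔮} : Finset (Place K)) := by
    rintro v hv (hpv | hv0)
    · rw [h𝔮 v hv hpv, Finset.mem_singleton]
    · exact absurd hv0 (Set.notMem_empty v)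
  haveI hKOfin : Finite KO := finite_kummerOutside E n {Sum.inr 𝔮}
  haveI : Finite ↥(KO ⊓ C) := Finite.of_injective _ (AddSubgroup.inclusion_injective inf_le_left)
  haveI : Finite ↥(kummerOutside E (p ^ k) {Sum.inr 𝔮} ⊓
      ((AddCommGroup.torsion
          (E.baseChange (Place.Completion (Sum.inr 𝔭 : Place K))).toAffine.Point).map
        (E.localKummerMap (Place.Completion (Sum.inr 𝔭 : Place K)) hnZ)).comap
        (galoisCohomology.localization (E.torsionGaloisModule ((p ^ k : ℕ) : ℤ)) (Sum.inr 𝔭) 1)) :=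
    Finite.of_injective _ (AddSubgroup.inclusion_injective inf_le_left)
  obtain ⟨hfin, hglue⟩ :=
    LevelKummer.finite_and_natCard_selmerGroup_acLevelStructure_le_torsion E p k 𝔭 ∅ {Sum.inr 𝔮}
      hT hnZ
  refine ⟨hfin, hglue.trans ?_⟩
  change Nat.card ↥(KO ⊓ C) ≤ _
  -- (2) `#(KO ⊓ C) ≤ [KO : Sel] · #(Sel ⊓ C)`
  have hSelKO : Sel ≤ KO := selmerGroup_le_kummerOutside E n _
  refine (natCard_inf_le_relIndex_mul KO Sel C hSelKO).trans ?_
  -- (3) Part B at `𝔮`, then the symmetry `𝔮 ↔ 𝔭`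
  have hpp : IsPrimePow n := ⟨p, k, (Fact.out : p.Prime).prime, hk, rfl⟩
  have hB : Sel.relIndex KO ≤ L₁ := by
    have h := Relaxation.relIndex_selmerGroup_kummerOutside_le_of_facts E n 𝔮 hpp hPT hEP
    rw [← LocalIndexSymmetry.index_range_baseChange_sup_eq_of_algEquiv_smul W σ hσ (n : ℤ)] at h
    exact h.trans hL₁
  -- (4) Part A with the torsion-valued condition at `𝔭`
  have hA : Nat.card ↥(Sel ⊓ C) ≤ S * L₂ * G := by
    have hdiv := E.zsmul_geomPoints_surjective_holds hnZ
    have h := StrictAtPlace.natCard_selmerGroup_inf_comap_mul_index_le E (𝔭.adicCompletion K) hnZ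
      hdiv (AddCommGroup.torsion (E.baseChange (𝔭.adicCompletion K)).toAffine.Point)
    change Nat.card ↥(Sel ⊓ C) * _ ≤ _ at h
    rw [hM, hL₂] at h
    have h' : Nat.card ↥(Sel ⊓ C) * M ≤ (S * L₂ * G) * M := by
      calc Nat.card ↥(Sel ⊓ C) * M
          ≤ Nat.card ↥(E.sha ⊓ AddSubgroup.torsionBy E.galH1 (n : ℤ)) *
              (((zsmulAddGroupHom ((p ^ k : ℕ) : ℤ) : E.toAffine.Point →+ _).range).index * L₂) := h
        _ ≤ S * ((M * G) * L₂) := Nat.mul_le_mul hS (Nat.mul_le_mul_right _ hN)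
        _ = (S * L₂ * G) * M := by ring
    exact Nat.le_of_mul_le_mul_right h' (Nat.pos_of_ne_zero hM0)
  calc Sel.relIndex KO * Nat.card ↥(Sel ⊓ C) ≤ L₁ * (S * L₂ * G) := Nat.mul_le_mul hB hA


end Level

/-! ## §2. Rank-one index bookkeeping WITH torsion -/

section Indices

variable {A : Type*} [AddCommGroup A]

/-- **`[A : nA] ≤ n · #A_tors`** for an abelian group with a "rank-one coordinate" `c : A → ℤ`,
`c Q = 1`, `ker c` torsion, and FINITE torsion (e.g. `E(K)` of rank one, ANY torsion): the map
`x ↦ c(x) mod n` is onto `ℤ/n` with kernel `K ⊇ nA`, and `K ≤ nA + A_tors` (`x = n·(a • Q) + t`), so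
`[A : nA] = n · [K : nA] ≤ n · [A_tors : A_tors ∩ nA] ≤ n · #A_tors`. The torsion-free case `= n` is
`RankOne.index_range_zsmul_pow_eq`. [cite: JetchevSkinnerWan2017, Prop. 3.2.1 (proof, arXiv:1512.06894 p. 10), `E(K)/p^k E(K)` for rank one] -/
theorem index_range_zsmul_le_mul_card_torsion (c : A →+ ℤ) (Q : A) (hQ : c Q = 1)
    (hker : ∀ x : A, c x = 0 → IsOfFinAddOrder x) [Finite (AddCommGroup.torsion A)] (n : ℕ)
    [NeZero n] :
    ((zsmulAddGroupHom (n : ℤ) : A →+ A).range).index ≤ n * Nat.card (AddCommGroup.torsion A) := by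
  set R := (zsmulAddGroupHom (n : ℤ) : A →+ A).range with hR
  set T := AddCommGroup.torsion A with hT
  set f : A →+ ZMod n := (Int.castAddHom (ZMod n)).comp c with hf
  have hfs : Function.Surjective f :=
    (ZMod.intCast_surjective (n := n)).comp (RankOne.coord_surjective c Q hQ)
  -- `nA ≤ ker f ≤ nA + T`
  have hRker : R ≤ f.ker := by
    rintro _ ⟨y, rfl⟩
    rw [AddMonoidHom.mem_ker, zsmulAddGroupHom_apply, map_zsmul, natCast_zsmul, nsmul_eq_mul,
      ZMod.natCast_self, zero_mul]
  have hkerRT : f.ker ≤ R ⊔ T := by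
    intro x hx
    rw [AddMonoidHom.mem_ker] at hx
    change ((c x : ℤ) : ZMod n) = 0 at hx
    rw [ZMod.intCast_zmod_eq_zero_iff_dvd] at hx
    obtain ⟨a, ha⟩ := hx
    have ht : x - c x • Q ∈ T :=
      (AddCommGroup.mem_torsion _).mpr (RankOne.isOfFinAddOrder_sub_coord_zsmul c Q hQ hker x)
    have hx' : x = (n : ℤ) • (a • Q) + (x - c x • Q) := by rw [ha, smul_smul]; abel
    rw [hx']
    exact AddSubgroup.add_mem _ (AddSubgroup.mem_sup_left ⟨a • Q, rfl⟩)
      (AddSubgroup.mem_sup_right ht)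
  -- `[A : ker f] = n`
  have hfi : f.ker.index = n := by
    rw [AddSubgroup.index_ker, AddMonoidHom.range_eq_top.mpr hfs, AddSubgroup.card_top, Nat.card_zmod]
  -- `[ker f : nA] ≤ [nA + T : nA] = [T : T ∩ nA] ≤ #T`
  have hTcard : Nat.card T ≠ 0 := Nat.card_pos.ne'
  have hrelT : R.relIndex T ≠ 0 := fun h0 ↦ hTcard (Nat.eq_zero_of_zero_dvd (h0 ▸ R.relIndex_dvd_card T))
  have hrel : R.relIndex f.ker ≤ Nat.card T := by
    have h1 : R.relIndex f.ker ≤ R.relIndex (R ⊔ T) :=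
      AddSubgroup.relIndex_le_of_le_right hkerRT (by rwa [AddSubgroup.relIndex_sup_left])
    rw [AddSubgroup.relIndex_sup_left] at h1
    exact h1.trans (Nat.le_of_dvd (Nat.pos_of_ne_zero hTcard) (R.relIndex_dvd_card T))
  calc R.index = R.relIndex f.ker * f.ker.index := (AddSubgroup.relIndex_mul_index hRker).symm
    _ ≤ Nat.card T * n := Nat.mul_le_mul hrel hfi.le
    _ = n * Nat.card T := mul_comm _ _

variable {G : Type*} [AddCommGroup G]

/-- **`T ⊔ (nG ⊔ f(A)) = T ⊔ (nG ⊔ ℤ·f(Q))`** for `f : A → G`, `T` the torsion of `G` and `A` with a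
rank-one coordinate (`x = c(x) • Q + t`, `t` torsion, `f t ∈ T`): the torsion-aware form of
`LocalIndex.range_nsmul_sup_range_eq_of_source` (which needs `A[p] = 0`). [folklore] -/
theorem torsion_sup_range_nsmul_sup_range_eq (f : A →+ G) (c : A →+ ℤ) (Q : A)
    (hA : ∀ a : A, IsOfFinAddOrder (a - c a • Q)) (n : ℕ) :
    AddCommGroup.torsion G ⊔ ((nsmulAddMonoidHom n : G →+ G).range ⊔ f.range) =
      AddCommGroup.torsion G ⊔ ((nsmulAddMonoidHom n : G →+ G).range ⊔ AddSubgroup.zmultiples (f Q)) := by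
  apply le_antisymm
  · refine sup_le le_sup_left (sup_le (le_sup_right.trans' le_sup_left) ?_)
    rintro _ ⟨a, rfl⟩
    have ha : f a = c a • f Q + f (a - c a • Q) := by rw [map_sub, map_zsmul]; abel
    rw [ha]
    refine AddSubgroup.add_mem _ (AddSubgroup.mem_sup_right (AddSubgroup.mem_sup_right
      (AddSubgroup.zsmul_mem _ (AddSubgroup.mem_zmultiples _) _))) (AddSubgroup.mem_sup_left ?_)
    exact (AddCommGroup.mem_torsion _).mpr (f.isOfFinAddOrder (hA a))
  · refine sup_le le_sup_left (sup_le (le_sup_right.trans' le_sup_left) ?_)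
    exact AddSubgroup.zmultiples_le.mpr (AddSubgroup.mem_sup_right (AddSubgroup.mem_sup_right ⟨Q, rfl⟩))

/-- **`[G : nG + f(A)] ≤ [G : nG + ℤ·f(Q)]`** (`f(A) ⊇ ℤ·f(Q)`, the latter of finite index). [folklore] -/
theorem index_range_nsmul_sup_range_le (f : A →+ G) (Q : A) (n : ℕ)
    [((nsmulAddMonoidHom n : G →+ G).range ⊔ AddSubgroup.zmultiples (f Q)).FiniteIndex] :
    ((nsmulAddMonoidHom n : G →+ G).range ⊔ f.range).index ≤
      ((nsmulAddMonoidHom n : G →+ G).range ⊔ AddSubgroup.zmultiples (f Q)).index :=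
  AddSubgroup.index_antitone
    (sup_le_sup_left (AddSubgroup.zmultiples_le.mpr (AddMonoidHom.mem_range.mpr ⟨Q, rfl⟩)) _)

end Indices

/-! ## §3. Finiteness of `Sel_𝔭(K, E[p^∞])` at a rank-one datum WITHOUT `E(K)[p] = 0` -/

section Finite

/-- **Castella's Selmer group `Sel_𝔭(K, E[p^∞])` is FINITE at a rank-one datum, ANY reduction type at
`p`, ANY torsion of `E(K)` and of `E(ℚ_p)`** — `K` imaginary quadratic with `p` split, `rank E(K) = 1`,
`Ш(E/K)` finite, `𝔭 ∣ p` of degree one: door-c4 gen 2's `selmerCardBoundTorsion_of_rankOne_anyReduction`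
(port of multr1-p2's `X11b.selmerCardBoundTorsion_of_rankOne`, JSW17 Prop. 3.2.1 `≤` at every level
`p^k` + passage to the limit) run with the level bound `natCard_level_le_of_indices_anyTorsion` and the
torsion-aware indices of §2, so that NO hypothesis `E(K)[p] = 0` is needed (the uniform level bound picks
up the factor `#E(K)_tors`, finite by Mordell–Weil). CONDITIONAL on the cited
`poitouTate_sum_localTatePairing_eq_zero K` (Milne ADT I 4.10, reciprocity half; a consequence of
`poitouTate_selmerStructure_duality K`); Milne I 2.8 at `K_𝔭̄` is the tree theorem
`localEulerPoincareCharacteristic_adicCompletionEP`. [cite: JetchevSkinnerWan2017, Prop. 3.2.1 (proof, arXiv:1512.06894 pp. 10–11)]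
[cite: Castella2018, proof of Thm. 2.3, (3.2.1) and (calcul) (arXiv:1704.06608 pp. 5–6)]
[cite: MilneADT2006, Ch. I, Thm. 4.10(b) and Thm. 2.8] -/
theorem finite_selmerAcBase_of_rankOne_anyTorsion (W : WeierstrassCurve ℚ) [W.IsElliptic]
    [W.IsGloballyMinimal] (p : ℕ) [Fact p.Prime] (K : Type) [Field K] [NumberField K]
    (hPT : poitouTate_sum_localTatePairing_eq_zero K)
    (hK : IsImaginaryQuadratic K) (hsplit : SplitsIn K p)
    (hrank : (W.baseChange K).mordellWeilRank = 1) (hSha : (W.baseChange K).ShaFinite)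
    (𝔭 : HeightOneSpectrum (𝓞 K)) (h𝔭 : ((p : ℕ) : 𝓞 K) ∈ 𝔭.asIdeal)
    (he : 𝔭.asIdeal.ramificationIdx (𝓞 ℚ) = 1) (hf : 𝔭.asIdeal.inertiaDeg (𝓞 ℚ) = 1) :
    Finite (selmerAcBase (W.baseChange K) p 𝔭 ∅) := by
  set E := W.baseChange K with hEdef
  set G := W.baseChange ℚ_[p] with hGdef
  haveI hEK : E.IsElliptic := by rw [hEdef, baseChange]; infer_instance
  have h2 : Module.finrank ℚ K = 2 := hK.1
  have hp : p.Prime := Fact.out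
  haveI hShaFin : Finite E.sha := hSha
  haveI : Finite (AddCommGroup.torsion E.toAffine.Point) := E.finite_torsion_point
  set ιp := embAt K p 𝔭 h𝔭 he hf with hιp
  set f : E.toAffine.Point →+ G.toAffine.Point := Affine.Point.map (W' := W) ιp.toRatAlgHom with hfdef
  have hfinj : Function.Injective f := Affine.Point.map_injective (W' := W) ιp.toRatAlgHom
  -- a coordinate `c : E(K) → ℤ` and a generator `Q` (torsion ALLOWED)
  obtain ⟨c, Q, hcQ, hcker⟩ := RankOne.exists_coord_of_mordellWeilRank_eq_one E hrank
  have hA : ∀ a : E.toAffine.Point, IsOfFinAddOrder (a - c a • Q) :=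
    RankOne.isOfFinAddOrder_sub_coord_zsmul c Q hcQ hcker
  have hQinf : ¬ IsOfFinAddOrder Q := fun hQ => by
    have h := RankOne.coord_eq_zero_of_isOfFinAddOrder c hQ
    rw [hcQ] at h
    exact one_ne_zero h
  have hxinf : ¬ IsOfFinAddOrder (f Q) := fun hx => hQinf ((hfinj.isOfFinAddOrder_iff).mp hx)
  -- the `ℤ_p`-coordinate `Ψ` on `E(ℚ_p)`: `Ψ(E(ℚ_p)) = p^m ℤ_p`, `p^m = #E(ℚ_p)[p^∞]`
  haveI hfi2 : (G.formalFiltration 2).FiniteIndex := G.finiteIndex_formalFiltration 2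
  obtain ⟨φ, -⟩ := LocalIndex.exists_addEquiv_valuation_psi_padicPointOf W p (K := K)
  obtain ⟨m, hmrange, hmcard, -⟩ :=
    LocalIndex.exists_pow_eq_card_and_le_valuation_psi (G.formalFiltration 2) φ
  haveI : Finite (AddCommGroup.torsion G.toAffine.Point) :=
    LocalIndex.finite_torsion (G.formalFiltration 2) φ
  set eQ := (LocalIndex.psi (G.formalFiltration 2) φ (f Q)).valuation with heQdef
  -- the subgroup `p^k E(ℚ_p) + ℤ f(Q)` has finite (indeed `p`-power times `#E(ℚ_p)[p^∞]`) index
  have hH₀ : ∀ k : ℕ, (((nsmulAddMonoidHom (p ^ k) : G.toAffine.Point →+ _).range ⊔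
      AddSubgroup.zmultiples (f Q))).index ≠ 0 := fun k ↦ by
    set H₀ := (nsmulAddMonoidHom (p ^ k) : G.toAffine.Point →+ _).range ⊔ AddSubgroup.zmultiples (f Q)
    rw [← AddSubgroup.relIndex_mul_index (le_sup_right : H₀ ≤ AddCommGroup.torsion G.toAffine.Point ⊔ H₀),
      AddSubgroup.relIndex_sup_right,
      LocalIndex.index_torsion_sup_range_nsmul_sup_zmultiples (G.formalFiltration 2) φ hmrange (f Q)
        hxinf k]
    exact mul_ne_zero AddSubgroup.FiniteIndex.index_ne_zero (pow_ne_zero _ hp.ne_zero)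
  -- the two primes above `p`
  obtain ⟨σ, 𝔮, hσ, -, -, hall⟩ := LocalIndexTransport.exists_conj_prime_of_splitsIn K p h2 hsplit h𝔭
  have h𝔮 : ∀ v : HeightOneSpectrum (𝓞 K), v ≠ 𝔭 → ((p : ℕ) : 𝓞 K) ∈ v.asIdeal → v = 𝔮 :=
    fun v hv hpv => (hall v hpv).resolve_left hv
  -- `#Ш[p^∞] = S`
  set S := Nat.card (AddCommGroup.primaryComponent E.sha p) with hSdef
  set Tg := Nat.card (AddCommGroup.torsion E.toAffine.Point) with hTg
  -- THE LEVEL BOUNDS (uniform in `k`)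
  set B : ℕ := (p ^ (eQ - m) * p ^ m) * (S * p ^ (eQ - m) * Tg) with hBdef
  have hS1 : 1 ≤ S := Nat.one_le_iff_ne_zero.mpr Nat.card_pos.ne'
  have hTg1 : 1 ≤ Tg := Nat.one_le_iff_ne_zero.mpr Nat.card_pos.ne'
  have hlevel : ∀ k, Finite (acLevelStructure E p k 𝔭 ∅).selmerGroup ∧
      Nat.card (acLevelStructure E p k 𝔭 ∅).selmerGroup ≤ B := by
    intro k
    rcases Nat.eq_zero_or_pos k with rfl | hk
    · obtain ⟨hfin, hle⟩ := finite_and_natCard_selmerGroup_acLevelStructure_zero E p 𝔭 ∅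
      refine ⟨hfin, hle.trans ?_⟩
      calc 1 ≤ S := hS1
        _ ≤ S * p ^ (eQ - m) := Nat.le_mul_of_pos_right _ (pow_pos hp.pos _)
        _ ≤ S * p ^ (eQ - m) * Tg := Nat.le_mul_of_pos_right _ hTg1
        _ ≤ (p ^ (eQ - m) * p ^ m) * (S * p ^ (eQ - m) * Tg) :=
            Nat.le_mul_of_pos_left _ (Nat.mul_pos (pow_pos hp.pos _) (pow_pos hp.pos _))
    · haveI : NeZero (p ^ k) := ⟨pow_ne_zero _ hp.ne_zero⟩
      -- the indices at level `k`, read in `E(ℚ_p)` through `Ψ`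
      have hL₁ : ((Affine.Point.baseChange (W' := W.baseChange K) K (𝔭.adicCompletion K)).range ⊔
          (zsmulAddGroupHom ((p ^ k : ℕ) : ℤ) :
            ((W.baseChange K).baseChange (𝔭.adicCompletion K)).toAffine.Point →+ _).range).index ≤
          p ^ min k (eQ - m) * p ^ m := by
        rw [LocalIndexTransport.index_range_baseChange_sup_eq_padic K p 𝔭 h𝔭 he hf W,
          RankOne.range_zsmulAddGroupHom_natCast, sup_comm]
        change ((nsmulAddMonoidHom (p ^ k) : G.toAffine.Point →+ _).range ⊔ f.range).index ≤ _
        haveI : (((nsmulAddMonoidHom (p ^ k) : G.toAffine.Point →+ _).range ⊔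
            AddSubgroup.zmultiples (f Q))).FiniteIndex := ⟨hH₀ k⟩
        refine (index_range_nsmul_sup_range_le f Q (p ^ k)).trans ?_
        rw [hmcard]
        exact LocalIndex.index_range_nsmul_sup_zmultiples_le (G.formalFiltration 2) φ hmrange
          (f Q) hxinf k
      have hM : (AddCommGroup.torsion ((W.baseChange K).baseChange (𝔭.adicCompletion K)).toAffine.Point ⊔
          (zsmulAddGroupHom ((p ^ k : ℕ) : ℤ) :
            ((W.baseChange K).baseChange (𝔭.adicCompletion K)).toAffine.Point →+ _).range).index =
          p ^ k := by
        rw [index_torsion_sup_range_zsmul_eq_padic K p 𝔭 h𝔭 he hf W,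
          RankOne.range_zsmulAddGroupHom_natCast]
        exact LocalIndex.index_torsion_sup_range_nsmul (G.formalFiltration 2) φ k
      have hN : ((zsmulAddGroupHom ((p ^ k : ℕ) : ℤ) : E.toAffine.Point →+ _).range).index ≤
          p ^ k * Tg := index_range_zsmul_le_mul_card_torsion c Q hcQ hcker (p ^ k)
      have hL₂ : ((Affine.Point.baseChange (W' := W.baseChange K) K (𝔭.adicCompletion K)).range ⊔
          (AddCommGroup.torsion ((W.baseChange K).baseChange (𝔭.adicCompletion K)).toAffine.Point ⊔
            (zsmulAddGroupHom ((p ^ k : ℕ) : ℤ) :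
              ((W.baseChange K).baseChange (𝔭.adicCompletion K)).toAffine.Point →+ _).range)).index =
          p ^ min k (eQ - m) := by
        rw [index_range_baseChange_sup_torsion_sup_eq_padic K p 𝔭 h𝔭 he hf W,
          RankOne.range_zsmulAddGroupHom_natCast]
        change (f.range ⊔ (AddCommGroup.torsion G.toAffine.Point ⊔
          (nsmulAddMonoidHom (p ^ k) : G.toAffine.Point →+ _).range)).index = _
        have hrw : f.range ⊔ (AddCommGroup.torsion G.toAffine.Point ⊔
            (nsmulAddMonoidHom (p ^ k) : G.toAffine.Point →+ _).range) =
            AddCommGroup.torsion G.toAffine.Point ⊔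
              ((nsmulAddMonoidHom (p ^ k) : G.toAffine.Point →+ _).range ⊔
                AddSubgroup.zmultiples (f Q)) := by
          rw [← torsion_sup_range_nsmul_sup_range_eq f c Q hA (p ^ k)]
          ac_rfl
        rw [hrw]
        exact LocalIndex.index_torsion_sup_range_nsmul_sup_zmultiples (G.formalFiltration 2) φ
          hmrange (f Q) hxinf k
      obtain ⟨hfin, hle⟩ := natCard_level_le_of_indices_anyTorsion W K p k 𝔭 𝔮 hk σ hσ h𝔮 hPT
        (localEulerPoincareCharacteristic_adicCompletionEP K 𝔮) hL₁ hM (pow_ne_zero _ hp.ne_zero) hN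
        hL₂ (natCard_sha_inf_torsionBy_le E p k)
      refine ⟨hfin, hle.trans ?_⟩
      have hmin : p ^ min k (eQ - m) ≤ p ^ (eQ - m) := Nat.pow_le_pow_right hp.pos (min_le_right _ _)
      exact Nat.mul_le_mul (Nat.mul_le_mul_right _ hmin)
        (Nat.mul_le_mul (Nat.mul_le_mul_left _ hmin) le_rfl)
  -- pass to the limit
  obtain ⟨hfinSel, -⟩ := LevelKummer.exists_finite_selmerAcBase_natCard_le E p 𝔭 ∅
    E.zsmul_geomPoints_surjective_holds B (fun k => (hlevel k).1) (fun k => (hlevel k).2)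
  exact hfinSel

end Finite

end Summit.BirchSwinnertonDyer.BirchSwinnertonDyer.Theorems.SchneiderFreeAdditiveX3

end
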